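import Mathlib
import HarnessLib
import Summits.NavierStokesRegularity.NavierStokesRegularity.Theorems.PoloidalWindowRigidity.Negative.StuartVorticity
import Summits.NavierStokesRegularity.NavierStokesRegularity.Theorems.PoloidalWindowRigidity.Negative.GermOffFourStrata

/-!
# Crux K2 `PoloidalWindowRigidity` (stmt-NavierStokesRegularity-19708), target (ISO) of the K2 lead's decomposition of
# the research stub `stub_lrcGeneric` — negative side: (ISO) is FALSE without the Oseen-mild identity

Negative-side support (refuter seat ns-regularity-refuter1, cell ns-regularity-ideate; D-0081 §C), brick K-37. The K2
lead (ns-poloidal-K2-p1 g5: `Cruxes/PoloidalWindowRigidity/TARGETS-lrcGeneric-g5.md`, idea card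
`Cruxes/PoloidalWindowRigidity/Ideas/isoparametric-circle.md`) reduces the research stub `stub_lrcGeneric` of skeleton
lrc-jet v4 (LRC″ on the thick stratum) to two targets plus landed files: (ISO) + (AXIS) + the Levi-Civita–Segre
dichotomy `Literature.Analysis.Calculus.PlaneIsoparametric{,Circles,Lines}` + the glue
`…Theorems.PoloidalWindowDoorPoloidalWindowRigidityIsoparametricGlue`. (ISO) reads: «for a profile of the route's
Type-I class, poloidal along `e₂`, non-degenerate with the thick-stratum pin on a window: `∃ s < 0`, `∃ U` open
non-empty, `∃ ψ` with `curl v(s) = (∂₁ψ, −∂₀ψ, 0)` on `U`, `∃ a b` with `(∂₀ψ)² + (∂₁ψ)² = a(x₂, ψ)` and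
`Δₕψ = b(x₂, ψ)` on `U`» — a per-plane ISOPARAMETRIC vortex-line foliation.

This file is the kernel certificate that (ISO) — like the stub it refines (`…Negative.LrcGenericFalseWithoutMild`) — is
not a kinematic fact: with the Oseen-mild identity (M) deleted from the class hypotheses it is FALSE, and it stays
false with (M) replaced by the frozen constraint (F) and real-analyticity of the slices (A). Witness: the Stuart column
of `…Negative.StuartColumn` / `…Negative.StuartVorticity` (Kelvin–Stuart cat's eye `W = e^{x₀} + e^{−x₀} + cos x₁`,
`W ΔW − |∇W|² = 3`, dressed poloidally by `sin x₂`). Certified here: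
* `stuartClebsch`, `fderiv_stuartClebsch_e1`, `neg_fderiv_stuartClebsch_e0`: the CLEBSCH HALF of (ISO) holds, globally
  — `ψ(s) = (−s)^{-1/2} sin x₂ (log W − 3W⁻²)` is a stream function of `curl v(s)` in every horizontal plane;
* `transDefect_eq`: the transnormal defect in closed form,
  `D(‖ω‖²)(y)[ω(y)] = −2 (−s)^{-3/2} sin³x₂ · sin x₁ · (e^{x₀} − e^{−x₀}) · G³ · W` (`G = W⁻¹ + 6W⁻³`), and
  `stuartProfile_not_transnormal`: it vanishes on NO non-empty open set of any slice `s < 0` (identity theorem; it is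
  non-zero at `e₀ + (π/2)e₁ + (π/2)e₂`) — the vortex-line foliation `{W = c} × {x₂ = h}` is transnormal, a fortiori
  isoparametric, on no open set (`|∇ₕW|² = W² − 2W cos x₁ − 3` is not a function of `W`);
* `fderiv_normSq_self_eq_zero_of_isoparametric_clebsch`: the kinematic lemma, for ANY field `ω` — a Clebsch potential
  with `(∂₀ψ)² + (∂₁ψ)² = a(x₂, ψ)`, `a(x₂, ·)` differentiable, forces `D(‖ω‖²)[ω] = 0` (chain rule along the vortex
  line, on which the height is constant and `dψ[ω] = 0`);
* `iso_false_without_mild`: the hypotheses of `stub_lrcGeneric` VERBATIM minus (M) do not give even the weakest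
  reading of (ISO) (`ψ` merely differentiable on `U`, each `a(x₂, ·)` differentiable, NO second equation, `U`
  anywhere in `ℝ³`); `iso_false_without_mild_frozen_analytic`: nor with (F) + (A) added in place of (M).
Reading for the K2 lead and for item 20428 (K2-p3): of the two halves of (ISO) the Clebsch pair is kinematic (poloidal
+ divergence-free), while per-plane isoparametricity of the vortex lines is exactly where (M) must enter — consistent
with the lead's label «RESEARCH — the crux's content» and with the isoparametric detector of STRUCT-NOTES-g5 §5 being
exact on the DYNAMIC jets only. Shape remarks for registering (ISO) as a stub travel separately (evidence note K-37).

WHAT THIS IS NOT: not a claim about Navier–Stokes regularity and not a refutation of any route declaration or of the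
stub — a kernel-checked certificate that hypothesis (M) cannot be dropped from target (ISO).
-/

noncomputable section

-- the summit and its single sub-problem share the name (CONVENTIONS §1), as in every Theorems file
set_option linter.dupNamespace false

namespace Summit.NavierStokesRegularity.NavierStokesRegularity.Theorems.PoloidalWindowRigidity.Negative

open MeasureTheory Set Function Filter Topology Metric
open scoped RealInnerProductSpace InnerProductSpace
open Literature.Analysis Literature.Analysis.FluidPDE

local notation "E3" => EuclideanSpace ℝ (Fin 3)
local notation "π" i => (EuclideanSpace.proj (𝕜 := ℝ) (i : Fin 3) : EuclideanSpace ℝ (Fin 3) →L[ℝ] ℝ)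
local notation "𝐞" i => (EuclideanSpace.single (i : Fin 3) (1 : ℝ) : EuclideanSpace ℝ (Fin 3))

/-! ## The transnormal defect of the Stuart column -/

/-- The **transnormal defect** of the slice `s`: the derivative of `‖curl v(s)‖²` along the vortex line through `y`,
`D(‖ω‖²)(y)[ω(y)]` (`ω = curl v(s)`).  A vortex-line foliation is transnormal on an open set iff this vanishes there.
[folklore] -/
def transDefect (s : ℝ) (y : E3) : ℝ :=
  fderiv ℝ (fun z : E3 => ‖curl (stuartProfile s) z‖ ^ 2) y (curl (stuartProfile s) y)

/-- `cos x₁ = W − e^{x₀} − e^{−x₀}`. [folklore] -/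
theorem cos_eq_stuartW_sub (y : E3) :
    Real.cos (y 1) = stuartW y - (Real.exp (y 0) + Real.exp (-(y 0))) := by
  simp only [stuartW]; ring

/-- **Closed form of the transnormal defect**: with `S = sin x₂`, `σ = sin x₁`, `P = e^{x₀} − e^{−x₀}`,
`G = W⁻¹ + 6W⁻³`, `D(‖ω‖²)[ω] = −2 (−s)^{-3/2} S³ σ P G³ W` (the `G′`-terms cancel because `W` is constant along
`ω`; what is left is `G²S²·⟨ω_h/ (cellAmp·S·G), ∇ₕ|∇ₕW|²⟩`-type: `|∇ₕW|² = W² − 2W cos x₁ − 3` is NOT a function of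
`W`). [folklore] -/
theorem transDefect_eq (s : ℝ) (y : E3) :
    transDefect s y =
      -(2 * cellAmp s ^ 3 * Real.sin (y 2) ^ 3 * Real.sin (y 1) * (Real.exp (y 0) - Real.exp (-(y 0))) *
        ((stuartW y)⁻¹ + 6 * (stuartW y)⁻¹ ^ 3) ^ 3 * stuartW y) := by
  unfold transDefect
  rw [((hasFDerivAt_curl_stuartProfile s y).norm_sq).fderiv]
  simp only [smul_apply, ContinuousLinearMap.comp_apply, innerSL_apply_apply,
    PiLp.inner_apply, RCLike.inner_apply, conj_trivial, Fin.sum_univ_three, PiLp.smul_apply, smul_eq_mul,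
    nsmul_eq_mul, Nat.cast_ofNat, curl_stuartProfile_apply_zero, curl_stuartProfile_apply_one,
    curl_stuartProfile_apply_two, stuartVortDeriv_apply_zero, stuartVortDeriv_apply_one, stuartVortDeriv_apply_two]
  rw [cos_eq_stuartW_sub]
  ring

/-- The transnormal defect vanishes exactly on the planes `x₀ = 0`, `sin x₁ = 0`, `sin x₂ = 0`; in particular it is
non-zero at every point with `x₀ ≠ 0`, `sin x₁ ≠ 0`, `sin x₂ ≠ 0` of every slice `s < 0`. [folklore] -/
theorem transDefect_ne_zero {s : ℝ} (hs : s < 0) {y : E3} (h0 : y 0 ≠ 0) (h1 : Real.sin (y 1) ≠ 0)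
    (h2 : Real.sin (y 2) ≠ 0) : transDefect s y ≠ 0 := by
  rw [transDefect_eq]
  have hP : Real.exp (y 0) - Real.exp (-(y 0)) ≠ 0 := by
    intro h
    have := Real.exp_injective (sub_eq_zero.1 h)
    exact h0 (by linarith)
  exact neg_ne_zero.2 (mul_ne_zero (mul_ne_zero (mul_ne_zero (mul_ne_zero (mul_ne_zero (mul_ne_zero two_ne_zero
    (pow_ne_zero 3 (cellAmp_pos hs).ne')) (pow_ne_zero 3 h2)) h1) hP) (pow_ne_zero 3 (stuartG_pos y).ne'))
    (stuartW_ne_zero y))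

/-- The point `e₀ + (π/2) e₁ + (π/2) e₂`, at which the transnormal defect of every slice `s < 0` is non-zero. [folklore] -/
def isoTestPoint : E3 := (1 : ℝ) • (𝐞 0) + (Real.pi / 2) • (𝐞 1) + (Real.pi / 2) • (𝐞 2)

/-- The transnormal defect is non-zero at the test point. [folklore] -/
theorem transDefect_isoTestPoint_ne_zero {s : ℝ} (hs : s < 0) : transDefect s isoTestPoint ≠ 0 := by
  have a0 : isoTestPoint 0 = 1 := by simp [isoTestPoint]
  have a1 : isoTestPoint 1 = Real.pi / 2 := by simp [isoTestPoint]
  have a2 : isoTestPoint 2 = Real.pi / 2 := by simp [isoTestPoint]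
  refine transDefect_ne_zero hs ?_ ?_ ?_
  · rw [a0]; exact one_ne_zero
  · rw [a1, Real.sin_pi_div_two]; exact one_ne_zero
  · rw [a2, Real.sin_pi_div_two]; exact one_ne_zero

/-- The transnormal defect of every slice is real-analytic on `ℝ³` (its closed form is a polynomial in
`sin xᵢ, e^{±x₀}, W, W⁻¹`). [folklore] -/
theorem analyticOnNhd_transDefect (s : ℝ) : AnalyticOnNhd ℝ (transDefect s) univ := by
  intro x _
  have hY : ∀ k : Fin 3, AnalyticAt ℝ (fun y : E3 => y k) x := fun k => (π k).analyticAt x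
  have hr := analyticAt_stuartW_inv x
  have hG : AnalyticAt ℝ (fun y : E3 => (stuartW y)⁻¹ + 6 * (stuartW y)⁻¹ ^ 3) x :=
    hr.add (analyticAt_const.mul (hr.pow 3))
  have hP : AnalyticAt ℝ (fun y : E3 => Real.exp (y 0) - Real.exp (-(y 0))) x :=
    (analyticAt_rexp.comp (hY 0)).sub (analyticAt_rexp.comp (hY 0).neg)
  rw [show transDefect s = fun y : E3 =>
      -(2 * cellAmp s ^ 3 * Real.sin (y 2) ^ 3 * Real.sin (y 1) * (Real.exp (y 0) - Real.exp (-(y 0))) *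
        ((stuartW y)⁻¹ + 6 * (stuartW y)⁻¹ ^ 3) ^ 3 * stuartW y) from funext (transDefect_eq s)]
  exact (((((analyticAt_const.mul ((Real.analyticAt_sin.comp (hY 2)).pow 3)).mul
    (Real.analyticAt_sin.comp (hY 1))).mul hP).mul (hG.pow 3)).mul (analyticAt_stuartW x)).neg

/-- **The Stuart column is transnormal on no window**: on no non-empty open set of any slice `s < 0` is `‖curl v(s)‖`
constant along the vortex lines (identity theorem: the real-analytic defect would vanish on `ℝ³`, but it is non-zero
at `e₀ + (π/2) e₁ + (π/2) e₂`).  Equivalently: the per-plane vortex-line foliation `{W = const}` (Kelvin–Stuart cat's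
eyes) is a foliation by the level curves of a function with `|∇ₕW|² = W² − 2W cos x₁ − 3`, which is not a function of
`W` — the foliation is not isoparametric on any open set. [folklore] -/
theorem stuartProfile_not_transnormal {s : ℝ} (hs : s < 0) {U : Set E3} (hU : IsOpen U) (hne : U.Nonempty)
    (h : ∀ y ∈ U, fderiv ℝ (fun z : E3 => ‖curl (stuartProfile s) z‖ ^ 2) y (curl (stuartProfile s) y) = 0) :
    False := by
  obtain ⟨y₀, hy₀⟩ := hne
  exact transDefect_isoTestPoint_ne_zero hs
    (eq_zero_of_eqOn_open (analyticOnNhd_transDefect s) hU hy₀ (fun y hy => h y hy) isoTestPoint)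

/-! ## A planar-isoparametric Clebsch potential makes the vortex-line foliation transnormal -/

/-- `w = w₀ e₀ + w₁ e₁ + w₂ e₂` on `ℝ³`. [folklore] -/
theorem eq_sum_single (w : E3) : w = (w 0) • (𝐞 0) + (w 1) • (𝐞 1) + (w 2) • (𝐞 2) := by
  ext i
  fin_cases i <;> simp

/-- **Isoparametric Clebsch potential ⇒ transnormal vortex lines** (the kinematic heart of the (ISO) target).  Let
`ω` be a field on an open `U ⊆ ℝ³` with a Clebsch (stream) potential `ψ` in the horizontal planes,
`ω = (∂₁ψ, −∂₀ψ, 0)` on `U`, whose horizontal gradient has squared length a function of height and of `ψ`: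
`(∂₀ψ)² + (∂₁ψ)² = a(x₂, ψ)` on `U`, `a(x₂, ·)` differentiable.  Then `‖ω‖²` is constant along `ω` to first order at
every point of `U`: `D(‖ω‖²)(y)[ω(y)] = 0` (chain rule along the vortex line `r ↦ y + r ω(y)`, on which the height is
constant and `dψ[ω] = ∂₀ψ ∂₁ψ − ∂₁ψ ∂₀ψ = 0`).  No differentiability of `ω` is assumed (where `‖ω‖²` is not
differentiable the derivative is `0` by convention). [folklore] -/
theorem fderiv_normSq_self_eq_zero_of_isoparametric_clebsch {U : Set E3} (hU : IsOpen U) {ω : E3 → E3}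
    {ψ : E3 → ℝ} {a : ℝ → ℝ → ℝ}
    (hω0 : ∀ z ∈ U, ω z 0 = fderiv ℝ ψ z (𝐞 1)) (hω1 : ∀ z ∈ U, ω z 1 = -fderiv ℝ ψ z (𝐞 0))
    (hω2 : ∀ z ∈ U, ω z 2 = 0)
    (hiso : ∀ z ∈ U, fderiv ℝ ψ z (𝐞 0) ^ 2 + fderiv ℝ ψ z (𝐞 1) ^ 2 = a (z 2) (ψ z))
    {y : E3} (hy : y ∈ U) (hψ : DifferentiableAt ℝ ψ y) (ha : DifferentiableAt ℝ (a (y 2)) (ψ y)) :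
    fderiv ℝ (fun z : E3 => ‖ω z‖ ^ 2) y (ω y) = 0 := by
  -- the vortex line through `y`, to first order
  set ℓ : ℝ → E3 := fun r => y + r • ω y with hℓ
  have hℓ0 : ℓ 0 = y := by simp [hℓ]
  have hℓd : HasDerivAt ℓ (ω y) 0 := by
    have := ((hasDerivAt_id (0 : ℝ)).smul_const (ω y)).const_add y
    simpa [hℓ] using this
  have hℓc : Continuous ℓ := by simp only [hℓ]; fun_prop
  have hnear : ∀ᶠ r in 𝓝 (0 : ℝ), ℓ r ∈ U :=
    (hℓc.tendsto' 0 y hℓ0).eventually_mem (hU.mem_nhds hy)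
  -- the height is constant along the line
  have hh : ∀ r, ℓ r 2 = y 2 := by
    intro r; simp [hℓ, hω2 y hy]
  -- along the line, `‖ω‖² = a(y₂, ψ)` near `r = 0`
  have hfg : (fun r => a (y 2) (ψ (ℓ r))) =ᶠ[𝓝 0] (fun r => ‖ω (ℓ r)‖ ^ 2) := by
    filter_upwards [hnear] with r hr
    rw [EuclideanSpace.real_norm_sq_eq, Fin.sum_univ_three, hω0 _ hr, hω1 _ hr, hω2 _ hr, ← hh r, ← hiso _ hr]
    ring
  -- `dψ(y)[ω(y)] = 0`
  have hdψ : fderiv ℝ ψ y (ω y) = 0 := by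
    rw [eq_sum_single (ω y), map_add, map_add, map_smul, map_smul, map_smul, hω0 y hy, hω1 y hy, hω2 y hy]
    simp only [smul_eq_mul]
    ring
  -- derivative of the right-hand side along the line: `a′(ψ) · dψ[ω] = 0`
  have hg : HasDerivAt (fun r => a (y 2) (ψ (ℓ r))) (deriv (a (y 2)) (ψ y) * fderiv ℝ ψ y (ω y)) 0 := by
    have hψℓ : HasDerivAt (fun r => ψ (ℓ r)) (fderiv ℝ ψ y (ω y)) 0 :=
      hψ.hasFDerivAt.comp_hasDerivAt_of_eq 0 hℓd hℓ0.symm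
    exact ha.hasDerivAt.comp_of_eq 0 hψℓ (by rw [hℓ0])
  rw [hdψ, mul_zero] at hg
  -- derivative of the left-hand side along the line: the transnormal defect (or `‖ω‖²` is not differentiable at `y`)
  by_cases hF : DifferentiableAt ℝ (fun z : E3 => ‖ω z‖ ^ 2) y
  · have hf : HasDerivAt (fun r => ‖ω (ℓ r)‖ ^ 2) (fderiv ℝ (fun z : E3 => ‖ω z‖ ^ 2) y (ω y)) 0 :=
      hF.hasFDerivAt.comp_hasDerivAt_of_eq 0 hℓd hℓ0.symm
    exact hf.unique (hg.congr_of_eventuallyEq hfg.symm)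
  · rw [fderiv_zero_of_not_differentiableAt hF]; rfl

/-! ## The Clebsch potential of the Stuart column: the Clebsch half of (ISO) holds, the isoparametric half fails -/

/-- The per-plane stream function of the vorticity pattern: `Ψ(x) = sin x₂ (log W − 3 W⁻²)`. [folklore] -/
def stuartClebschFn (y : E3) : ℝ :=
  Real.sin (y 2) * (Real.log (stuartW y) - 3 * (stuartW y)⁻¹ ^ 2)

/-- The per-plane Clebsch (stream) potential of the vorticity of the slice `s`:
`ψ(s)(x) = (−s)^{-1/2} sin x₂ (log W − 3 W⁻²)`, `curl v(s) = (∂₁ψ, −∂₀ψ, 0)`. [folklore] -/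
def stuartClebsch (s : ℝ) (y : E3) : ℝ :=
  cellAmp s * stuartClebschFn y

/-- The derivative of `Ψ`: `dΨ = (log W − 3W⁻²) cos x₂ dx₂ + sin x₂ (W⁻¹ + 6W⁻³) dW`. [folklore] -/
def stuartClebschFnDeriv (y : E3) : E3 →L[ℝ] ℝ :=
  (Real.log (stuartW y) - 3 * (stuartW y)⁻¹ ^ 2) • (Real.cos (y 2) • (π 2)) +
    Real.sin (y 2) • (((stuartW y)⁻¹ + 6 * (stuartW y)⁻¹ ^ 3) •
      (Real.exp (y 0) • (π 0) + Real.exp (-(y 0)) • (-(π 0)) + (-(Real.sin (y 1))) • (π 1)))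

/-- `dΨ(y) w` in coordinates. [folklore] -/
theorem stuartClebschFnDeriv_apply (y w : E3) : stuartClebschFnDeriv y w =
    (Real.log (stuartW y) - 3 * (stuartW y)⁻¹ ^ 2) * (Real.cos (y 2) * w 2) +
      Real.sin (y 2) * (((stuartW y)⁻¹ + 6 * (stuartW y)⁻¹ ^ 3) *
        (Real.exp (y 0) * w 0 + Real.exp (-(y 0)) * (-(w 0)) + (-(Real.sin (y 1))) * w 1)) := by
  simp only [stuartClebschFnDeriv, smul_apply, add_apply, neg_apply, smul_eq_mul, PiLp.proj_apply]

/-- `Ψ` is differentiable with derivative `stuartClebschFnDeriv` (`d(log W − 3W⁻²) = (W⁻¹ + 6W⁻³) dW`).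
[folklore] -/
theorem hasFDerivAt_stuartClebschFn (y : E3) : HasFDerivAt stuartClebschFn (stuartClebschFnDeriv y) y := by
  have hW := stuartW_ne_zero y
  have h2 : HasFDerivAt (fun z : E3 => z 2) (π 2) y := (π 2).hasFDerivAt
  have hs2 := (Real.hasDerivAt_sin (y 2)).comp_hasFDerivAt y h2
  have hlog := (Real.hasDerivAt_log hW).comp_hasFDerivAt y (hasFDerivAt_stuartW y)
  have hinv := (hasDerivAt_inv hW).comp_hasFDerivAt y (hasFDerivAt_stuartW y)
  have H : HasFDerivAt stuartClebschFn _ y := hs2.mul (hlog.sub ((hinv.pow 2).const_mul (3 : ℝ)))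
  refine H.congr_fderiv ?_
  ext w
  rw [stuartClebschFnDeriv_apply]
  simp
  field_simp
  ring

/-- `ψ(s)` is differentiable with derivative `(−s)^{-1/2} dΨ`. [folklore] -/
theorem hasFDerivAt_stuartClebsch (s : ℝ) (y : E3) :
    HasFDerivAt (stuartClebsch s) (cellAmp s • stuartClebschFnDeriv y) y :=
  (hasFDerivAt_stuartClebschFn y).const_mul (cellAmp s)

/-- `∂₁ψ(s) = (curl v(s))₀`. [folklore] -/
theorem fderiv_stuartClebsch_e1 (s : ℝ) (y : E3) :
    fderiv ℝ (stuartClebsch s) y (𝐞 1) = curl (stuartProfile s) y 0 := by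
  have a0 : ((𝐞 1) : E3) 0 = 0 := by simp
  have a1 : ((𝐞 1) : E3) 1 = 1 := by simp
  have a2 : ((𝐞 1) : E3) 2 = 0 := by simp
  rw [(hasFDerivAt_stuartClebsch s y).fderiv, smul_apply, stuartClebschFnDeriv_apply, a0, a1, a2,
    curl_stuartProfile_apply_zero, smul_eq_mul]
  ring

/-- `−∂₀ψ(s) = (curl v(s))₁`. [folklore] -/
theorem neg_fderiv_stuartClebsch_e0 (s : ℝ) (y : E3) :
    -fderiv ℝ (stuartClebsch s) y (𝐞 0) = curl (stuartProfile s) y 1 := by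
  have a0 : ((𝐞 0) : E3) 0 = 1 := by simp
  have a1 : ((𝐞 0) : E3) 1 = 0 := by simp
  have a2 : ((𝐞 0) : E3) 2 = 0 := by simp
  rw [(hasFDerivAt_stuartClebsch s y).fderiv, smul_apply, stuartClebschFnDeriv_apply, a0, a1, a2,
    curl_stuartProfile_apply_one, smul_eq_mul]
  ring

/-- `ψ(s)` is differentiable on `ℝ³`. [folklore] -/
theorem differentiable_stuartClebsch (s : ℝ) : Differentiable ℝ (stuartClebsch s) :=
  fun y => (hasFDerivAt_stuartClebsch s y).differentiableAt

/-- **The isoparametric half of (ISO) fails for the Stuart column, for every height-dependent profile function**: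
on no non-empty open set of any slice `s < 0` is `(∂₀ψ)² + (∂₁ψ)² = a(x₂, ψ)` with `a(x₂, ·)` differentiable —
although the Clebsch half holds globally (`fderiv_stuartClebsch_e1`, `neg_fderiv_stuartClebsch_e0`).  (Any other
Clebsch potential of the same vorticity differs from `ψ(s)` by a locally height-only function, so this is no
artefact of the normalisation; the packaged theorem below quantifies over all potentials anyway.) [folklore] -/
theorem stuartClebsch_not_isoparametric {s : ℝ} (hs : s < 0) {U : Set E3} (hU : IsOpen U) (hne : U.Nonempty)
    (a : ℝ → ℝ → ℝ) (ha : ∀ y ∈ U, DifferentiableAt ℝ (a (y 2)) (stuartClebsch s y))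
    (hiso : ∀ y ∈ U, fderiv ℝ (stuartClebsch s) y (𝐞 0) ^ 2 + fderiv ℝ (stuartClebsch s) y (𝐞 1) ^ 2 =
      a (y 2) (stuartClebsch s y)) : False :=
  stuartProfile_not_transnormal hs hU hne fun y hy =>
    fderiv_normSq_self_eq_zero_of_isoparametric_clebsch hU (fun z _ => (fderiv_stuartClebsch_e1 s z).symm)
      (fun z _ => (neg_fderiv_stuartClebsch_e0 s z).symm) (fun z _ => curl_stuartProfile_apply_two s z) hiso hy
      (differentiable_stuartClebsch s y) (ha y hy)

/-! ## (ISO) without the Oseen-mild identity is false -/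

/-- **Target (ISO) of the K2 lead's decomposition of `stub_lrcGeneric` is FALSE without the Oseen-mild identity (M).**
The hypotheses are those of `stub_lrcGeneric` (skeleton lrc-jet v4) VERBATIM with (M) deleted — Type-I rate (R),
continuity (C), divergence-free (D), poloidal (P); a non-empty open window of the backward slab carrying the three
non-degeneracy pins and the thick-stratum pin — and the conclusion is the WEAKEST reading of (ISO): on some slice
`s < 0` and some non-empty open `U ⊆ ℝ³` (anywhere — a fortiori inside the window's slice) a differentiable Clebsch
potential `ψ` of `curl v(s)` whose horizontal gradient has squared length `a(x₂, ψ)` with `a(y₂, ·)`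
differentiable at `ψ(y)` for `y ∈ U` only (TARGETS asks `ψ ∈ C³`, `a ∈ C²` AND the second equation `Δₕψ = b(x₂, ψ)`; all dropped here, which
only strengthens the negation).  Witness: the Stuart column (`C = 6`, window `stuartWindow`): it has a global Clebsch
potential, but its vortex-line foliation is transnormal on no open set (`stuartProfile_not_transnormal`).  Reading:
(ISO) is not a kinematic fact of the poloidal Type-I class — per-plane isoparametricity of the vortex lines is where
(M) must enter. [folklore] -/
theorem iso_false_without_mild :
    ¬ (∀ (C : ℝ) (v : ℝ → EuclideanSpace ℝ (Fin 3) → EuclideanSpace ℝ (Fin 3)),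
      Literature.Analysis.FluidPDE.HasTypeITimeDecay C v →
      ContinuousOn (Function.uncurry v) (Set.Iio (0 : ℝ) ×ˢ Set.univ) →
      (∀ t < 0, Literature.Analysis.FluidPDE.VectorCalculus.IsDivFree (v t)) →
      (∀ s < 0, ∀ y, ⟪Literature.Analysis.FluidPDE.curl (v s) y, EuclideanSpace.single 2 1⟫_ℝ = 0) →
      ∀ W : Set (ℝ × EuclideanSpace ℝ (Fin 3)), IsOpen W → W.Nonempty → W ⊆ Set.Iio (0 : ℝ) ×ˢ Set.univ →
        (∀ z ∈ W, Literature.Analysis.FluidPDE.curl (v z.1) z.2 ≠ 0 ∧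
          (fderiv ℝ (v z.1) z.2 (EuclideanSpace.single 0 1) 2 ≠ 0 ∨ fderiv ℝ (v z.1) z.2 (EuclideanSpace.single 1 1) 2 ≠ 0) ∧
          (fderiv ℝ (v z.1) z.2 (EuclideanSpace.single 2 1) 0 ≠ 0 ∨ fderiv ℝ (v z.1) z.2 (EuclideanSpace.single 2 1) 1 ≠ 0)) →
        (∀ m : ℝ → ℝ → ℝ, ∀ W₁ : Set (ℝ × EuclideanSpace ℝ (Fin 3)), W₁ ⊆ W → IsOpen W₁ → W₁.Nonempty →
          ∃ z ∈ W₁, ∃ b : Fin 3, b ≠ 2 ∧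
            fderiv ℝ (v z.1) z.2 (EuclideanSpace.single 2 1) b ≠
              m z.1 (z.2 2) * fderiv ℝ (v z.1) z.2 (EuclideanSpace.single b 1) 2) →
        ∃ s : ℝ, s < 0 ∧ ∃ U : Set (EuclideanSpace ℝ (Fin 3)), IsOpen U ∧ U.Nonempty ∧
          ∃ ψ : EuclideanSpace ℝ (Fin 3) → ℝ, DifferentiableOn ℝ ψ U ∧
            (∀ y ∈ U, Literature.Analysis.FluidPDE.curl (v s) y 0 = fderiv ℝ ψ y (EuclideanSpace.single 1 1) ∧
              Literature.Analysis.FluidPDE.curl (v s) y 1 = -fderiv ℝ ψ y (EuclideanSpace.single 0 1)) ∧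
            ∃ a : ℝ → ℝ → ℝ, (∀ y ∈ U, DifferentiableAt ℝ (a (y 2)) (ψ y)) ∧
              ∀ y ∈ U, fderiv ℝ ψ y (EuclideanSpace.single 0 1) ^ 2 + fderiv ℝ ψ y (EuclideanSpace.single 1 1) ^ 2 =
                a (y 2) (ψ y)) := by
  intro H
  obtain ⟨s, hs, U, hU, hne, ψ, hψ, hcl, a, ha, hiso⟩ := H 6 stuartProfile hasTypeITimeDecay_stuartProfile
    continuousOn_stuartProfile (fun t _ => isDivFree_stuartProfile t) (fun s _ y => poloidal_stuartProfile s y)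
    stuartWindow isOpen_stuartWindow stuartWindow_nonempty stuartWindow_subset stuartProfile_pins
    (fun m W₁ hW₁ hW₁o hW₁n => stuartProfile_slope_not_timeHeight m W₁ hW₁ hW₁o hW₁n)
  exact stuartProfile_not_transnormal hs hU hne fun y hy =>
    fderiv_normSq_self_eq_zero_of_isoparametric_clebsch hU (fun z hz => (hcl z hz).1) (fun z hz => (hcl z hz).2)
      (fun z _ => curl_stuartProfile_apply_two s z) hiso hy (hψ.differentiableAt (hU.mem_nhds hy))
      (ha y hy)

/-- **The same, EVEN GRANTED the frozen Clebsch structure and real-analytic slices** ((M) REPLACED by (F) the frozen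
constraint `⟪Dv(s)(y)·curl v(s)(y), e₂⟫ = 0` and (A) real-analyticity of every slice, both consequences of (M) in the
class): still false on the same witness (`frozen_stuartProfile`, `analyticOnNhd_stuartProfile`). [folklore] -/
theorem iso_false_without_mild_frozen_analytic :
    ¬ (∀ (C : ℝ) (v : ℝ → EuclideanSpace ℝ (Fin 3) → EuclideanSpace ℝ (Fin 3)),
      Literature.Analysis.FluidPDE.HasTypeITimeDecay C v →
      ContinuousOn (Function.uncurry v) (Set.Iio (0 : ℝ) ×ˢ Set.univ) →
      (∀ t < 0, Literature.Analysis.FluidPDE.VectorCalculus.IsDivFree (v t)) →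
      (∀ s < 0, ∀ y, ⟪Literature.Analysis.FluidPDE.curl (v s) y, EuclideanSpace.single 2 1⟫_ℝ = 0) →
      (∀ s < 0, ∀ y, ⟪fderiv ℝ (v s) y (Literature.Analysis.FluidPDE.curl (v s) y), EuclideanSpace.single 2 1⟫_ℝ = 0) →
      (∀ s < 0, AnalyticOnNhd ℝ (v s) Set.univ) →
      ∀ W : Set (ℝ × EuclideanSpace ℝ (Fin 3)), IsOpen W → W.Nonempty → W ⊆ Set.Iio (0 : ℝ) ×ˢ Set.univ →
        (∀ z ∈ W, Literature.Analysis.FluidPDE.curl (v z.1) z.2 ≠ 0 ∧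
          (fderiv ℝ (v z.1) z.2 (EuclideanSpace.single 0 1) 2 ≠ 0 ∨ fderiv ℝ (v z.1) z.2 (EuclideanSpace.single 1 1) 2 ≠ 0) ∧
          (fderiv ℝ (v z.1) z.2 (EuclideanSpace.single 2 1) 0 ≠ 0 ∨ fderiv ℝ (v z.1) z.2 (EuclideanSpace.single 2 1) 1 ≠ 0)) →
        (∀ m : ℝ → ℝ → ℝ, ∀ W₁ : Set (ℝ × EuclideanSpace ℝ (Fin 3)), W₁ ⊆ W → IsOpen W₁ → W₁.Nonempty →
          ∃ z ∈ W₁, ∃ b : Fin 3, b ≠ 2 ∧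
            fderiv ℝ (v z.1) z.2 (EuclideanSpace.single 2 1) b ≠
              m z.1 (z.2 2) * fderiv ℝ (v z.1) z.2 (EuclideanSpace.single b 1) 2) →
        ∃ s : ℝ, s < 0 ∧ ∃ U : Set (EuclideanSpace ℝ (Fin 3)), IsOpen U ∧ U.Nonempty ∧
          ∃ ψ : EuclideanSpace ℝ (Fin 3) → ℝ, DifferentiableOn ℝ ψ U ∧
            (∀ y ∈ U, Literature.Analysis.FluidPDE.curl (v s) y 0 = fderiv ℝ ψ y (EuclideanSpace.single 1 1) ∧
              Literature.Analysis.FluidPDE.curl (v s) y 1 = -fderiv ℝ ψ y (EuclideanSpace.single 0 1)) ∧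
            ∃ a : ℝ → ℝ → ℝ, (∀ y ∈ U, DifferentiableAt ℝ (a (y 2)) (ψ y)) ∧
              ∀ y ∈ U, fderiv ℝ ψ y (EuclideanSpace.single 0 1) ^ 2 + fderiv ℝ ψ y (EuclideanSpace.single 1 1) ^ 2 =
                a (y 2) (ψ y)) := by
  intro H
  obtain ⟨s, hs, U, hU, hne, ψ, hψ, hcl, a, ha, hiso⟩ := H 6 stuartProfile hasTypeITimeDecay_stuartProfile
    continuousOn_stuartProfile (fun t _ => isDivFree_stuartProfile t) (fun s _ y => poloidal_stuartProfile s y)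
    (fun s _ y => frozen_stuartProfile s y) (fun s _ => analyticOnNhd_stuartProfile s) stuartWindow
    isOpen_stuartWindow stuartWindow_nonempty stuartWindow_subset stuartProfile_pins
    (fun m W₁ hW₁ hW₁o hW₁n => stuartProfile_slope_not_timeHeight m W₁ hW₁ hW₁o hW₁n)
  exact stuartProfile_not_transnormal hs hU hne fun y hy =>
    fderiv_normSq_self_eq_zero_of_isoparametric_clebsch hU (fun z hz => (hcl z hz).1) (fun z hz => (hcl z hz).2)
      (fun z _ => curl_stuartProfile_apply_two s z) hiso hy (hψ.differentiableAt (hU.mem_nhds hy))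
      (ha y hy)

end Summit.NavierStokesRegularity.NavierStokesRegularity.Theorems.PoloidalWindowRigidity.Negative

end
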